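import Summits.QuantumFields.BalabanUV.T4Continuum.Support.NE3ExactLineSums
import Summits.QuantumFields.BalabanUV.T4Continuum.Support.NE3CovariantBlockMean
import Summits.QuantumFields.BalabanUV.T4Continuum.Support.NE3CovariantLineSumsError
import HarnessLib

/-!
# T⁴ programme, node NE3, route H♮ (ρ-g22-2) · row K3 (file 2) — THE TOWER: `QstrIter L j W (gaugeDir W ζ) =
# gaugeDir (cavgIter L j W) (bmeanIterW L j W ζ) + DefIter L j W ζ` EXACTLY at any `W`, and in the multi-level small-field class
# `‖DefIter L (j+1) W ζ‖_∞ ≤ 20·loopRad(d,L,(prop1Radius)^[j] x)·‖ζ‖_∞` — k-FREE (the top level dominates geometrically)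

NE3 formalisation swarm `b2b-balaban-t4-ne3-formalise-*`, LEAF PROVER 04 (gen 5), row **K3** of the owner's design ρ-g22-2 (memo
`HOME/t4/b2b-balaban-t4-ne3-p1/g22/D-ne3p1-g22-1.md` §2 S3: «S_W(D_Wζ′) = D_U(bmean_W ζ′) + def(ζ′)»; S_W = this lineage's straight covariant
block-line tower `NE3CovariantLineSumsTower.QstrIter`).  File 1 (`NE3ExactLineSums`, p228292) did one level; the transported block mean is
leaf-02-g5's `NE3CovariantBlockMean.bmeanW` ∕ nested `bmeanIterW` (p227610, ρ-g22-2a r1: the transport convention of record).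

CONTENT (all [folklore]; 0 sorry; TWO data defs `DefIter` (the accumulated transport mismatch of the tower acting on a generator, by the
same inner-first recursion as `QstrIter`∕`ErrIter`) and `DSum` (its numeric level sum)):
§1 `Qstr_gaugeDir_eq_bmeanW` (file 1's identity read with `bmeanW`), the recursion lemmas, and **`QstrIter_gaugeDir_eq`** — for EVERY `j`,
   EVERY background `W` and EVERY generator `ζ` (no smallness, no periodicity):
   `QstrIter L j W (gaugeDir W ζ) = fun z κ => gaugeDir (cavgIter L j W) (bmeanIterW L j W ζ) z κ + DefIter L j W ζ z κ`
   (induction through `QstrIter_succ`, exact additivity `QstrIter_add`, `cavgIter_succ`, `bmeanIterW_succ`).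
§2 sup bounds: `norm_bmeanW_le_of_sup` (unitary `W`: `‖bmeanW L W μ z‖ ≤ ‖μ‖_∞`), `norm_bmeanIterW_le_of_sup` (class),
   `norm_defect_le_of_sup` (file 1's `norm_Qstr_gaugeDir_sub_le` against the sup: `≤ 10·loopRad d L a·‖ζ‖_∞`).
§3 `DSum d L 0 x = 0`, `DSum d L (j+1) x = L^j·(10·loopRad d L x) + DSum d L j (prop1Radius d L x)`; **`norm_DefIter_le`** (class:
   `IsUnitaryCfg W`, `0 ≤ x`, `LevelSmall d L j x`, `SmallField W x`, `‖ζ‖_∞ ≤ s`): `‖DefIter L (j+1) W ζ z κ‖ ≤ DSum d L (j+1) x·s`;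
   `DSum_le_top` (`L ≥ 2`: `DSum d L (j+1) x ≤ 2·(10·loopRad d L ((prop1Radius d L)^[j] x))` — per level the radius grows by `≥ L² ≥ 4`
   (`sq_mul_le_prop1Radius`) while the remaining line-sum weight drops by `L`, so the sum is geometric from the TOP); hence
   **`norm_DefIter_le_of_levelSmall`**: `‖DefIter L (j+1) W ζ z κ‖ ≤ 20·loopRad d L ((prop1Radius d L)^[j] x)·s` — k-FREE, and by
   `LevelSmall.top` the top radius `r_j = (prop1Radius)^[j] x` obeys `twoLevelSmall·r_j ≤ 1` (so the constant is `O(L²·r_j) = O(b∕L²)` in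
   the design's currency `M²a ≤ b∕L²`).

HONEST: multi-level covariant kinematics on OUR frame (bookkeeping + the crude per-level transport estimate of file 1); nothing about
Bałaban's minimisers; (P♮)_W, (ML_w) at W ≠ 1, T-E_w, NE3 NOT proved; spine PROVED 0∕9; finite T⁴ rung (B)+1 — NOT infinite volume, NOT
mass gap, NOT BetaPertH, NOT Clay.  PLACEMENT: `Summits/QuantumFields/BalabanUV/`.
-/

set_option autoImplicit false

open scoped BigOperators Matrix.Norms.L2Operator
open Finset

namespace Summit.QuantumFields.BalabanUV.T4Continuum.NE3ExactLineSumsTower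

open Literature.MathematicalPhysics.QuantumFieldTheory.Balaban1983to89
open B7Prop1Explicit B7Prop2Explicit
open T4AveragingDeficitWall (IsUnitaryCfg SmallField Ad)
open AveragingDeficitTransport (norm_Ad_of_unitary)
open AveragingDeficitChartCalculus (cavg)
open AveragingDeficitTwoLevelPrep (prop1Radius)
open AveragingDeficitMultiLevelPrep (cavgIter LevelSmall prop1Radius_nonneg)
open BlockAveragePushDirGauge (gaugeDir)
open BlockAveragePushDirSplit (sum_blockWeight_eq_one)
open NE3CovariantLineSums (Qstr)
open NE3CovariantLineSumsTower (QstrIter QstrIter_succ QstrIter_zero QstrIter_add)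
open NE3CovariantLineSumsError (norm_QstrIter_le_of_sup sq_mul_le_prop1Radius iterate_prop1Radius_nonneg)
open NE3TangentCovariantTower (step_small cavgIter_succ)
open NE3CovariantBlockMean (bmeanW bmeanIterW bmeanIterW_succ bmeanIterW_zero)
open NE3ExactLineSums (norm_Qstr_gaugeDir_sub_le)
open SpreadLift (loopRad)

noncomputable section

variable {d : ℕ} {n : Type*} [Fintype n] [DecidableEq n]

/-! ## §1 The accumulated defect and the exact tower identity -/

/-- File 1's one-level identity read with the named block mean: `Qstr L W (gaugeDir W ζ) z κ = gaugeDir (cavg L W) (bmeanW L W ζ) z κ +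
(Qstr L W (gaugeDir W ζ) z κ − gaugeDir (cavg L W) (bmeanW L W ζ) z κ)` — bookkeeping (`bmeanW` IS file 1's inline lambda). [folklore] -/
theorem Qstr_gaugeDir_eq_bmeanW (L : ℕ) (W : Site d → Fin d → (Matrix n n ℂ)ˣ) (ζ : Site d → Matrix n n ℂ) :
    Qstr L W (gaugeDir W ζ) = fun z κ => gaugeDir (cavg L W) (bmeanW L W ζ) z κ
      + (Qstr L W (gaugeDir W ζ) z κ - gaugeDir (cavg L W) (bmeanW L W ζ) z κ) := by
  funext z κ; abel

/-- THE ACCUMULATED TRANSPORT MISMATCH OF THE TOWER acting on a generator (inner-first, like `QstrIter`): `DefIter L 0 W ζ = 0`,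
`DefIter L (j+1) W ζ = DefIter L j (cavg L W) (bmeanW L W ζ) + QstrIter L j (cavg L W) (one-level defect of file 1)`. [folklore] -/
def DefIter (L : ℕ) : ℕ → (Site d → Fin d → (Matrix n n ℂ)ˣ) → (Site d → Matrix n n ℂ) → Site d → Fin d → Matrix n n ℂ
  | 0, _, _ => fun _ _ => 0
  | j + 1, W, ζ => fun z κ => DefIter L j (cavg L W) (bmeanW L W ζ) z κ
      + QstrIter L j (cavg L W) (fun y μ => Qstr L W (gaugeDir W ζ) y μ - gaugeDir (cavg L W) (bmeanW L W ζ) y μ) z κ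

/-- `DefIter L 0 W ζ = 0`. [folklore] -/
@[simp] theorem DefIter_zero (L : ℕ) (W : Site d → Fin d → (Matrix n n ℂ)ˣ) (ζ : Site d → Matrix n n ℂ) :
    DefIter L 0 W ζ = fun _ _ => 0 := rfl

/-- The recursion of `DefIter`. [folklore] -/
theorem DefIter_succ (L j : ℕ) (W : Site d → Fin d → (Matrix n n ℂ)ˣ) (ζ : Site d → Matrix n n ℂ) :
    DefIter L (j + 1) W ζ = fun z κ => DefIter L j (cavg L W) (bmeanW L W ζ) z κ
      + QstrIter L j (cavg L W) (fun y μ => Qstr L W (gaugeDir W ζ) y μ - gaugeDir (cavg L W) (bmeanW L W ζ) y μ) z κ := rfl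

/-- **THE TOWER IDENTITY, EXACT AT EVERY BACKGROUND**: for every `j`, `W`, `ζ`,
`QstrIter L j W (gaugeDir W ζ) = gaugeDir (cavgIter L j W) (bmeanIterW L j W ζ) + DefIter L j W ζ` — the straight covariant block-line
tower of an exact field is the coarse gauge direction of the nested transported block mean of its generator plus the accumulated transport
mismatch («S_W(D_Wζ) = D_U(bmean_W ζ) + def(ζ)» at k levels; no smallness enters the identity). [folklore] -/
theorem QstrIter_gaugeDir_eq (L : ℕ) : ∀ (j : ℕ) (W : Site d → Fin d → (Matrix n n ℂ)ˣ) (ζ : Site d → Matrix n n ℂ),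
    QstrIter L j W (gaugeDir W ζ) = fun z κ => gaugeDir (cavgIter L j W) (bmeanIterW L j W ζ) z κ + DefIter L j W ζ z κ
  | 0, W, ζ => by
      funext z κ
      rw [QstrIter_zero, DefIter_zero, bmeanIterW_zero]
      simp only [add_zero]
      rfl
  | j + 1, W, ζ => by
      funext z κ
      rw [QstrIter_succ, DefIter_succ, bmeanIterW_succ, cavgIter_succ]
      set D : Site d → Fin d → Matrix n n ℂ :=
        fun y μ => Qstr L W (gaugeDir W ζ) y μ - gaugeDir (cavg L W) (bmeanW L W ζ) y μ with hD
      have hsplit : Qstr L W (gaugeDir W ζ) = fun y μ => gaugeDir (cavg L W) (bmeanW L W ζ) y μ + D y μ := by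
        funext y μ; simp only [hD]; abel
      rw [hsplit, QstrIter_add, QstrIter_gaugeDir_eq L j (cavg L W) (bmeanW L W ζ)]
      simp only
      abel

/-! ## §2 Sup bounds: the block mean, the nested mean, the one-level defect -/

/-- `‖bmeanW L W μ z‖ ≤ s` for unitary `W` and `‖μ‖_∞ ≤ s` (`L ≥ 1`; isometric transports, weights summing to one). [folklore] -/
theorem norm_bmeanW_le_of_sup {L : ℕ} (hL : 1 ≤ L) {W : Site d → Fin d → (Matrix n n ℂ)ˣ} (hWu : IsUnitaryCfg W)
    {mu : Site d → Matrix n n ℂ} {s : ℝ} (hs : ∀ y : Site d, ‖mu y‖ ≤ s) (z : Site d) : ‖bmeanW L W mu z‖ ≤ s := by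
  have hwt := sum_blockWeight_eq_one (d := d) L hL
  have hsum : ∑ _r : Fin d → Fin L, ((L : ℝ) ^ d)⁻¹ * s = s := by rw [← Finset.sum_mul, hwt, one_mul]
  unfold bmeanW
  refine (norm_sum_le _ _).trans (le_of_le_of_eq (Finset.sum_le_sum fun r _ => ?_) hsum)
  rw [norm_smul, Real.norm_eq_abs, abs_of_nonneg (by positivity), norm_Ad_of_unitary (hol_mem_of hWu _ _)]
  exact mul_le_mul_of_nonneg_left (hs _) (by positivity)

/-- **THE NESTED MEAN DOES NOT GROW**: in the multi-level small-field class, `‖bmeanIterW L j W μ‖_∞ ≤ ‖μ‖_∞`. [folklore] -/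
theorem norm_bmeanIterW_le_of_sup [Nonempty n] {L : ℕ} (hL : 1 ≤ L) (j : ℕ) :
    ∀ {W : Site d → Fin d → (Matrix n n ℂ)ˣ} {x : ℝ}, IsUnitaryCfg W → 0 ≤ x → LevelSmall d L j x → SmallField W x →
    ∀ {mu : Site d → Matrix n n ℂ} {s : ℝ}, (∀ y : Site d, ‖mu y‖ ≤ s) → ∀ z : Site d, ‖bmeanIterW L (j + 1) W mu z‖ ≤ s := by
  induction j with
  | zero =>
      intro W x hWu hx hsm hWx mu s hs z
      rw [bmeanIterW_succ, bmeanIterW_zero]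
      exact norm_bmeanW_le_of_sup hL hWu hs z
  | succ j ih =>
      intro W x hWu hx hsm hWx mu s hs z
      obtain ⟨-, hW₁u, hr0, hW₁x⟩ := step_small hL hWu hx hsm.1 hWx
      rw [bmeanIterW_succ]
      exact ih hW₁u hr0 hsm.2 hW₁x (fun y => norm_bmeanW_le_of_sup hL hWu hs y) z

/-- **THE ONE-LEVEL DEFECT AGAINST THE SUP** (small-field class at one level): `‖Qstr L W (gaugeDir W ζ) z κ − gaugeDir (cavg L W) (bmeanW L W ζ) z κ‖
≤ 10·loopRad d L a·‖ζ‖_∞`. [folklore] -/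
theorem norm_defect_le_of_sup [Nonempty n] {L : ℕ} (hL : 1 ≤ L) {W : Site d → Fin d → (Matrix n n ℂ)ˣ} (hWu : IsUnitaryCfg W)
    {a : ℝ} (ha : 0 ≤ a) (h512 : 512 * (d + 1) * (d + 4) * (L : ℝ) ^ 2 * a ≤ 1) (hWa : SmallField W a)
    {ζ : Site d → Matrix n n ℂ} {s : ℝ} (hs : ∀ y : Site d, ‖ζ y‖ ≤ s) (z : Site d) (κ : Fin d) :
    ‖Qstr L W (gaugeDir W ζ) z κ - gaugeDir (cavg L W) (bmeanW L W ζ) z κ‖ ≤ 10 * loopRad d L a * s := by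
  have hρ : 0 ≤ 10 * loopRad d L a := by unfold loopRad; positivity
  have hwt := sum_blockWeight_eq_one (d := d) L hL
  have h := norm_Qstr_gaugeDir_sub_le hL hWu ha h512 hWa ζ z κ
  refine h.trans (mul_le_mul_of_nonneg_left ?_ hρ)
  calc ∑ r : Fin d → Fin L, (((L : ℝ) ^ d)⁻¹) * ‖ζ ((L : ℤ) • z + (L : ℤ) • e κ + boxVec L r)‖
      ≤ ∑ _r : Fin d → Fin L, ((L : ℝ) ^ d)⁻¹ * s :=
        Finset.sum_le_sum fun r _ => mul_le_mul_of_nonneg_left (hs _) (by positivity)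
    _ = s := by rw [← Finset.sum_mul, hwt, one_mul]

/-! ## §3 The accumulated defect through the tower: k-free -/

/-- THE LEVEL SUM of the defect weights (inner-first): `DSum d L 0 x = 0`, `DSum d L (j+1) x = L^j·(10·loopRad d L x) + DSum d L j (prop1Radius d L x)`
(the finest level's defect is carried through the remaining `j` straight averages, each of sup-weight `L`). [folklore] -/
def DSum (d L : ℕ) : ℕ → ℝ → ℝ
  | 0, _ => 0
  | j + 1, x => (L : ℝ) ^ j * (10 * loopRad d L x) + DSum d L j (prop1Radius d L x)

omit [Fintype n] [DecidableEq n] in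
/-- `DSum_succ`. [folklore] -/
theorem DSum_succ (d L j : ℕ) (x : ℝ) : DSum d L (j + 1) x = (L : ℝ) ^ j * (10 * loopRad d L x) + DSum d L j (prop1Radius d L x) := rfl

omit [Fintype n] [DecidableEq n] in
/-- `0 ≤ DSum d L j x` for `x ≥ 0`. [folklore] -/
theorem DSum_nonneg (d L : ℕ) : ∀ (j : ℕ) {x : ℝ}, 0 ≤ x → 0 ≤ DSum d L j x
  | 0, _, _ => le_rfl
  | j + 1, x, hx => by
      rw [DSum_succ]
      have h1 : 0 ≤ loopRad d L x := by unfold loopRad; positivity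
      have h2 := DSum_nonneg d L j (prop1Radius_nonneg (d := d) (L := L) hx)
      have h3 : 0 ≤ (L : ℝ) ^ j * (10 * loopRad d L x) := by positivity
      linarith

/-- **THE ACCUMULATED DEFECT IN THE CLASS** (sup currency): for unitary `W` with `SmallField W x`, `0 ≤ x`, `LevelSmall d L j x` and
`‖ζ‖_∞ ≤ s`: `‖DefIter L (j+1) W ζ z κ‖ ≤ DSum d L (j+1) x·s`. [folklore] -/
theorem norm_DefIter_le [Nonempty n] {L : ℕ} (hL : 1 ≤ L) (j : ℕ) :
    ∀ {W : Site d → Fin d → (Matrix n n ℂ)ˣ} {x : ℝ}, IsUnitaryCfg W → 0 ≤ x → LevelSmall d L j x → SmallField W x →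
    ∀ {ζ : Site d → Matrix n n ℂ} {s : ℝ}, 0 ≤ s → (∀ y : Site d, ‖ζ y‖ ≤ s) →
      ∀ (z : Site d) (κ : Fin d), ‖DefIter L (j + 1) W ζ z κ‖ ≤ DSum d L (j + 1) x * s := by
  induction j with
  | zero =>
      intro W x hWu hx hsm hWx ζ s hs0 hs z κ
      obtain ⟨h512, -, -, -⟩ := step_small hL hWu hx hsm hWx
      rw [DefIter_succ, DSum_succ]
      simp only [DefIter_zero, QstrIter_zero, zero_add, pow_zero, one_mul, DSum, add_zero]
      exact norm_defect_le_of_sup hL hWu hx h512 hWx hs z κ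
  | succ j ih =>
      intro W x hWu hx hsm hWx ζ s hs0 hs z κ
      obtain ⟨h512, hW₁u, hr0, hW₁x⟩ := step_small hL hWu hx hsm.1 hWx
      rw [DefIter_succ, DSum_succ]
      -- first term: the IH at `cavg W` on the generator `bmeanW W ζ` (sup still `≤ s`)
      have hbs : ∀ y : Site d, ‖bmeanW L W ζ y‖ ≤ s := fun y => norm_bmeanW_le_of_sup hL hWu hs y
      have h1 := ih hW₁u hr0 hsm.2 hW₁x hs0 hbs z κ
      -- second term: the finest defect carried through `j+1` straight averages of sup-weight `L` each
      have hDs : ∀ (y : Site d) (μ : Fin d), ‖Qstr L W (gaugeDir W ζ) y μ - gaugeDir (cavg L W) (bmeanW L W ζ) y μ‖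
          ≤ 10 * loopRad d L x * s := norm_defect_le_of_sup hL hWu hx h512 hWx hs
      have h2 := norm_QstrIter_le_of_sup hL j hW₁u hr0 hsm.2 hW₁x hDs z κ
      calc ‖DefIter L (j + 1) (cavg L W) (bmeanW L W ζ) z κ
            + QstrIter L (j + 1) (cavg L W)
                (fun y μ => Qstr L W (gaugeDir W ζ) y μ - gaugeDir (cavg L W) (bmeanW L W ζ) y μ) z κ‖
          ≤ DSum d L (j + 1) (prop1Radius d L x) * s + (L : ℝ) ^ (j + 1) * (10 * loopRad d L x * s) :=
            (norm_add_le _ _).trans (add_le_add h1 h2)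
        _ = ((L : ℝ) ^ (j + 1) * (10 * loopRad d L x) + DSum d L (j + 1) (prop1Radius d L x)) * s := by ring

omit [Fintype n] [DecidableEq n] in
/-- Per level the defect weight grows by at least `L²`: `L²·loopRad x ≤ loopRad (prop1Radius x)`. [folklore] -/
theorem sq_mul_loopRad_le (L : ℕ) (x : ℝ) : (L : ℝ) ^ 2 * loopRad d L x ≤ loopRad d L (prop1Radius d L x) := by
  have h := sq_mul_le_prop1Radius (d := d) L x
  have h0 : (0 : ℝ) ≤ 2 * (8 * ((d : ℝ) + 1) * ((d : ℝ) + 4) * (L : ℝ) ^ 2) := by positivity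
  calc (L : ℝ) ^ 2 * loopRad d L x = (2 * (8 * ((d : ℝ) + 1) * ((d : ℝ) + 4) * (L : ℝ) ^ 2)) * ((L : ℝ) ^ 2 * x) := by
        unfold loopRad; ring
    _ ≤ (2 * (8 * ((d : ℝ) + 1) * ((d : ℝ) + 4) * (L : ℝ) ^ 2)) * prop1Radius d L x := mul_le_mul_of_nonneg_left h h0
    _ = loopRad d L (prop1Radius d L x) := by unfold loopRad; ring

omit [Fintype n] [DecidableEq n] in
/-- **GEOMETRIC DOMINATION BY THE TOP LEVEL** (`L ≥ 2`, `x ≥ 0`): `DSum d L (j+1) x ≤ 2·(10·loopRad d L ((prop1Radius d L)^[j] x))`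
(indeed `≤ 2·top − L^j·(10·loopRad x)`). [folklore] -/
theorem DSum_le_top {L : ℕ} (hL : 2 ≤ L) : ∀ (j : ℕ) {x : ℝ}, 0 ≤ x →
    DSum d L (j + 1) x ≤ 2 * (10 * loopRad d L ((prop1Radius d L)^[j] x)) - (L : ℝ) ^ j * (10 * loopRad d L x)
  | 0, x, _ => by
      rw [DSum_succ]; simp only [DSum, add_zero, Function.iterate_zero, id_eq, pow_zero, one_mul]; linarith
  | j + 1, x, hx => by
      rw [DSum_succ, Function.iterate_succ_apply]
      have hx1 : 0 ≤ prop1Radius d L x := prop1Radius_nonneg (d := d) (L := L) hx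
      have ih := DSum_le_top hL j hx1
      -- `L^{j+1}·c(x) ≤ L^j·c(x₁)∕L ≤ L^j·c(x₁)∕2`: the new bottom term is at most half of the IH's slack
      have hL2 : (2 : ℝ) ≤ L := by exact_mod_cast hL
      have hc := sq_mul_loopRad_le (d := d) L x
      have hρ : 0 ≤ loopRad d L x := by unfold loopRad; positivity
      have hLj : (0 : ℝ) ≤ (L : ℝ) ^ j := by positivity
      have key : 2 * ((L : ℝ) ^ (j + 1) * (10 * loopRad d L x)) ≤ (L : ℝ) ^ j * (10 * loopRad d L (prop1Radius d L x)) := by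
        have hLL : 2 * (L : ℝ) ≤ (L : ℝ) ^ 2 := by nlinarith
        have h1 : 2 * (L : ℝ) * loopRad d L x ≤ (L : ℝ) ^ 2 * loopRad d L x := mul_le_mul_of_nonneg_right hLL hρ
        have h2 : 2 * (L : ℝ) * loopRad d L x ≤ loopRad d L (prop1Radius d L x) := h1.trans hc
        have e : 2 * ((L : ℝ) ^ (j + 1) * (10 * loopRad d L x)) = (L : ℝ) ^ j * (10 * (2 * (L : ℝ) * loopRad d L x)) := by ring
        rw [e]
        exact mul_le_mul_of_nonneg_left (by linarith) hLj
      linarith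

/-- **THE ACCUMULATED DEFECT IS k-FREE** (`L ≥ 2`): in the multi-level small-field class (`IsUnitaryCfg W`, `0 ≤ x`, `LevelSmall d L j x`,
`SmallField W x`) and for `‖ζ‖_∞ ≤ s`, `s ≥ 0`:
`‖DefIter L (j+1) W ζ z κ‖ ≤ 20·loopRad d L ((prop1Radius d L)^[j] x)·s` — only the TOP radius `r_j = (prop1Radius)^[j] x` enters, and
`twoLevelSmall d L·r_j ≤ 1` by `NE3CovariantLineSumsError.LevelSmall.top`. [folklore] -/
theorem norm_DefIter_le_of_levelSmall [Nonempty n] {L : ℕ} (hL : 2 ≤ L) (j : ℕ) {W : Site d → Fin d → (Matrix n n ℂ)ˣ} {x : ℝ}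
    (hWu : IsUnitaryCfg W) (hx : 0 ≤ x) (hsm : LevelSmall d L j x) (hWx : SmallField W x)
    {ζ : Site d → Matrix n n ℂ} {s : ℝ} (hs0 : 0 ≤ s) (hs : ∀ y : Site d, ‖ζ y‖ ≤ s) (z : Site d) (κ : Fin d) :
    ‖DefIter L (j + 1) W ζ z κ‖ ≤ 20 * loopRad d L ((prop1Radius d L)^[j] x) * s := by
  have h1 := norm_DefIter_le (by omega) j hWu hx hsm hWx hs0 hs z κ
  have h2 := DSum_le_top (d := d) hL j hx
  have hρ : 0 ≤ loopRad d L x := by unfold loopRad; positivity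
  have hLj : (0 : ℝ) ≤ (L : ℝ) ^ j * (10 * loopRad d L x) := by positivity
  have h3 : DSum d L (j + 1) x ≤ 20 * loopRad d L ((prop1Radius d L)^[j] x) := by linarith
  exact h1.trans (mul_le_mul_of_nonneg_right h3 hs0)

end

end Summit.QuantumFields.BalabanUV.T4Continuum.NE3ExactLineSumsTower
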